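import Mathlib
import Summits.NavierStokesRegularity.NavierStokesRegularity.Theorems.SubOnsagerCeilingSideBranchBlockTransitRelax
import Summits.NavierStokesRegularity.NavierStokesRegularity.Theorems.SubOnsagerCeilingSideBranchFractionEscape
import Summits.NavierStokesRegularity.NavierStokesRegularity.Theorems.SubOnsagerCeilingSideBranchShellZero
import HarnessLib

/-!
# Route SubOnsagerCeiling — the escape debt of `α_SB` is a UNIFORM PARKING BOUND (reduction, def-free)
# (helper file for item stmt-NavierStokesRegularity-25507 `OrthantTailCeiling`; `--supports`)

Capstone of brick «R-B».  The conditional refutations of the aside cruxes `OrthantTailCeiling` (stmt-25507)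
and `ForwardTailCeiling` (stmt-26608) on the side-branch dead-end table `α_SB = sideBranchTable` are modulo
fixed-fraction escape (`sideBranchCeilingEscapeAt_of_fractionEscape`, p826546): a fixed part `qE₀` of the
datum energy must have left every finite block `0..K` at a late `ν`-uniform time.  By the block relaxation
(`sideBranch_block_transit_relax`, this lineage) the chain and side modes of the block are then as small as
we please, and the idle component never moves; so what the block still holds sits in its dead-end POCKETS.
Hence the whole remaining debt is the

**UNIFORM PARKING BOUND** (hypothesis inline in `sideBranchCeilingEscapeAt_of_parkingBound`): there is
`q > 0` such that for every candidate ceiling `(θ, C)` some one-shell datum (`x₀ ≥ 0`, `s₀, z₀ ≥ 0`, no idle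
energy, `E₀ > 0`) has, for every depth `K`, a threshold `ν₀` such that along every regular `ν`-viscous
solution (`0 < ν ≤ ν₀`) on any window `[0,s]` that is non-negative on the shells `≥ 1` and obeys the
`(θ, C)` ceiling, the first `K+1` pockets never hold more than `(1 − q)E₀`:
`Σ_{j ≤ K} ½z_j(t)² ≤ (1 − q)E₀` for all `t ∈ [0,s]`.

* `sideBranch_quadTerm_three`, `sideBranch_idle_eq_zero` — the idle component `X_{3,k}` has no
  nonlinearity and stays `0`; `sideBranch_pocket_zero_nonneg` — `z₀ ≥ 0` is kept;
* `sideBranch_pocket_le_of_ceiling` — under the ceiling every pocket is capped by `√(2CE₀)`;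
* **`sideBranchCeilingEscapeAt_of_parkingBound`** — PARKING BOUND (`q`) `⇒ SideBranchCeilingEscapeAt ε₀`
  (via fraction escape with `q/2`: block relaxation to the level `ρ`, `(K+1)ρ² ≤ qE₀/2`, at `s = T₀`);
* `orthantTailCeiling_false_of_parkingBound`, `forwardTailCeiling_false_of_parkingBound` — BY NAME.

NOT proved here: the parking bound itself (numerically `88–90 %` of `E₀` is parked, lead's
`Cruxes/OrthantTailCeiling/REFUTATION-EVIDENCE.md` §5; for the bare Katz–Pavlović chain nothing is parked and
all energy escapes — Barbato–Flandoli–Morandin 2011).  It is a statement about the TRUE dynamics of the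
shallow shells: every bound derivable from the assumed ceiling alone scales with `C ≥ 1`.

HONEST FRAMING: MODEL lattice ODEs only (Tao 2016 §4 vocabulary; rung TL-M2Break); a reduction between
unproved statements plus elementary real analysis; settles nothing by itself; nothing here is a statement
about the Navier–Stokes equations. [cite: Tao2016AveragedNS, §4 (4.2)–(4.3), (4.5)];
Katz–Pavlović couplings: [cite: BarbatoMorandinRomito2011, §2].
-/

noncomputable section

-- the sub-problem namespace `NavierStokesRegularity.NavierStokesRegularity` is the tree's layout (D-0017)
set_option linter.dupNamespace false

namespace Summit.NavierStokesRegularity.NavierStokesRegularity.Theorems.SubOnsagerCeiling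

open Set Filter
open scoped Topology
open Literature.Analysis.FluidPDE.TaoCascade
open Summit.NavierStokesRegularity.NavierStokesRegularity.Theses.SubOnsagerCeiling

/-! ## The idle component and the datum-shell pocket -/

/-- Idle component: `quadTerm_{3,n} = 0` (no entry of `α_SB` has output index `3`). [this file] -/
theorem sideBranch_quadTerm_three (ε₀ : ℝ) (X : Fin 4 → ℤ → ℝ → ℝ) (n : ℤ) (t : ℝ) :
    quadTerm ε₀ sideBranchTable X 3 n t = 0 := by
  rw [quadTerm_four_shifts]
  simp [sideBranchTable_feed, sideBranchTable_up1, sideBranchTable_up2, sideBranchTable_inshell]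

section Solution

variable {ε₀ ν s : ℝ} {X : Fin 4 → ℤ → ℝ → ℝ}

/-- **The idle component stays zero**: `X_{3,k}(0) = 0 ⇒ X_{3,k} = 0` on `[0,s]`
(`Ẋ_{3,k} = −ν_k X_{3,k}`). [this file] -/
theorem sideBranch_idle_eq_zero
    (hder : ∀ (i : Fin 4) (k : ℤ), ∀ t ∈ Icc (0 : ℝ) s, HasDerivWithinAt (X i k)
      (quadTerm ε₀ sideBranchTable X i k t - ν * (1 + ε₀) ^ ((2 : ℝ) * k) * X i k t)
      (Icc (0 : ℝ) s) t)
    (k : ℤ) (h0 : X 3 k 0 = 0) {t : ℝ} (ht : t ∈ Icc (0 : ℝ) s) : X 3 k t = 0 := by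
  have hq : Continuous fun _ : ℝ => ν * (1 + ε₀) ^ ((2 : ℝ) * k) := continuous_const
  have h1 : 0 ≤ X 3 k t := by
    refine sideBranch_linear_sign (p := fun _ => 0) hq (hder 3 k) (fun u _ => ?_) (fun u _ => le_rfl)
      h0.symm.le ht
    rw [sideBranch_quadTerm_three]
  have h2 : 0 ≤ -X 3 k t := by
    have hder' : ∀ u ∈ Icc (0 : ℝ) s, HasDerivWithinAt (fun u => -X 3 k u)
        (-(quadTerm ε₀ sideBranchTable X 3 k u - ν * (1 + ε₀) ^ ((2 : ℝ) * k) * X 3 k u))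
        (Icc (0 : ℝ) s) u := fun u hu => (hder 3 k u hu).neg
    refine sideBranch_linear_sign (p := fun _ => 0) (y := fun u => -X 3 k u) hq hder'
      (fun u _ => ?_) (fun u _ => le_rfl) (by simp [h0]) ht
    rw [sideBranch_quadTerm_three]; ring
  linarith

/-- **The datum-shell pocket keeps its sign**: `z₀(0) ≥ 0 ⇒ z₀ ≥ 0` on `[0,s]`
(`ż₀ = (1/5)Λ_{-1}s_{-1}² − ν z₀`, source `≥ 0`). [this file] -/
theorem sideBranch_pocket_zero_nonneg (hε : 0 < ε₀)
    (hder : ∀ (i : Fin 4) (k : ℤ), ∀ t ∈ Icc (0 : ℝ) s, HasDerivWithinAt (X i k)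
      (quadTerm ε₀ sideBranchTable X i k t - ν * (1 + ε₀) ^ ((2 : ℝ) * k) * X i k t)
      (Icc (0 : ℝ) s) t)
    (h0 : 0 ≤ X 2 0 0) {t : ℝ} (ht : t ∈ Icc (0 : ℝ) s) : 0 ≤ X 2 0 t := by
  have hb : (0 : ℝ) < 1 + ε₀ := by linarith
  have hq : Continuous fun _ : ℝ => ν * (1 + ε₀) ^ ((2 : ℝ) * ((0 : ℤ) : ℝ)) := continuous_const
  refine sideBranch_linear_sign
    (p := fun u => (1 / 5 : ℝ) * (1 + ε₀) ^ ((5 : ℝ) * (((0 : ℤ) : ℝ) - 1) / 2) * X 1 (0 - 1) u ^ 2)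
    hq (hder 2 0) (fun u _ => ?_) (fun u _ => ?_) h0 ht
  · rw [sideBranch_quadTerm_two]
  · have : 0 ≤ (1 + ε₀) ^ ((5 : ℝ) * (((0 : ℤ) : ℝ) - 1) / 2) := Real.rpow_nonneg hb.le _
    positivity

/-- **Under the ceiling every pocket is capped**: if the `(θ, C)` tail ceiling holds on `[0,s]` (datum
energy `E₀ ≥ 0`, `C ≥ 0`, `θ ≥ 0`) and the shells below `0` are empty, then `z_j(t) ≤ √(2CE₀)` for every
shell `j` and `t ∈ [0,s]`. [this file] -/
theorem sideBranch_pocket_le_of_ceiling (hε : 0 < ε₀) {θ C E₀ : ℝ} (hθ : 0 ≤ θ) (hC : 0 ≤ C)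
    (hE₀ : 0 ≤ E₀)
    (hlow : ∀ (i : Fin 4) (k : ℤ), k < 0 → ∀ t : ℝ, X i k t = 0)
    (hceil : ∀ n N : ℕ, n ≤ N → ∀ u ∈ Icc (0 : ℝ) s,
      ∑ k ∈ Finset.Icc n N, ∑ i : Fin 4, (1 / 2 : ℝ) * X i (k : ℤ) u ^ 2 ≤
        C * E₀ * (1 + ε₀) ^ (-(2 * θ * (n : ℝ))))
    {t : ℝ} (ht : t ∈ Icc (0 : ℝ) s) (j : ℤ) : X 2 j t ≤ Real.sqrt (2 * C * E₀) := by
  have hb1 : (1 : ℝ) ≤ 1 + ε₀ := by linarith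
  rcases lt_or_ge j 0 with hj | hj
  · rw [hlow 2 j hj t]; exact Real.sqrt_nonneg _
  · obtain ⟨n, rfl⟩ := Int.eq_ofNat_of_zero_le hj
    have h1 := hceil n n le_rfl t ht
    rw [Finset.Icc_self, Finset.sum_singleton] at h1
    have h2 : (1 + ε₀) ^ (-(2 * θ * (n : ℝ))) ≤ 1 :=
      Real.rpow_le_one_of_one_le_of_nonpos hb1 (by
        have : 0 ≤ 2 * θ * (n : ℝ) := by positivity
        linarith)
    have h3 : C * E₀ * (1 + ε₀) ^ (-(2 * θ * (n : ℝ))) ≤ C * E₀ := by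
      have := mul_le_mul_of_nonneg_left h2 (mul_nonneg hC hE₀)
      simpa using this
    have h4 : (1 / 2 : ℝ) * X 2 (n : ℤ) t ^ 2 ≤ ∑ i : Fin 4, (1 / 2 : ℝ) * X i (n : ℤ) t ^ 2 :=
      Finset.single_le_sum (f := fun i => (1 / 2 : ℝ) * X i (n : ℤ) t ^ 2)
        (fun i _ => by positivity) (Finset.mem_univ 2)
    have h5 : X 2 (n : ℤ) t ^ 2 ≤ 2 * C * E₀ := by linarith
    calc X 2 (n : ℤ) t ≤ |X 2 (n : ℤ) t| := le_abs_self _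
      _ = Real.sqrt (X 2 (n : ℤ) t ^ 2) := (Real.sqrt_sq_eq_abs _).symm
      _ ≤ Real.sqrt (2 * C * E₀) := Real.sqrt_le_sqrt h5

end Solution

/-! ## PARKING BOUND ⇒ fixed-fraction escape ⇒ the ceiling-assisted escape -/

/-- **UNIFORM PARKING BOUND `→ SideBranchCeilingEscapeAt ε₀`.**  Hypothesis (inline): `q > 0` and for
every candidate ceiling `(θ, C)` a one-shell datum `X₀` with `X₀ 0, X₀ 1, X₀ 2 ≥ 0`, `X₀ 3 = 0`, `E₀ > 0`,
such that for every depth `K` there is `ν₀ > 0` with: for all `0 < ν ≤ ν₀`, all `s > 0` and every regular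
`ν`-viscous solution of `α_SB` on `[0,s]` from `X₀` (one-shell datum, no shells below `0`, weight bound,
continuous modes, exact equation within `[0,s]`), non-negative on the shells `≥ 1` and obeying the `(θ, C)`
tail ceiling on `[0,s]`, the POCKETS of the block obey `Σ_{j ≤ K} ½z_j(t)² ≤ (1 − q)E₀` for all `t ∈ [0,s]`.
Conclusion: `SideBranchCeilingEscapeAt ε₀`.  Proof: block relaxation (`sideBranch_block_transit_relax`, cap
`Z = √(2CE₀)+1` from the ceiling, level `ρ` with `(K+1)ρ² ≤ qE₀/2`, horizon `T₀`, window `s = T₀`), idle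
modes vanish, so `B_K(T₀) ≤ (K+1)ρ² + (1−q)E₀ ≤ (1 − q/2)E₀`; then `sideBranchCeilingEscapeAt_of_fractionEscape`.
MODEL lattice only; a reduction between unproved statements. [this file] -/
theorem sideBranchCeilingEscapeAt_of_parkingBound {ε₀ q : ℝ} (hε : 0 < ε₀) (hq : 0 < q)
    (h : ∀ θ : ℝ, 1 / 2 < θ → ∀ C : ℝ, 0 ≤ C →
      ∃ X₀ : Fin 4 → ℝ, 0 ≤ X₀ 0 ∧ 0 ≤ X₀ 1 ∧ 0 ≤ X₀ 2 ∧ X₀ 3 = 0 ∧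
      0 < (∑ i : Fin 4, (1 / 2 : ℝ) * X₀ i ^ 2) ∧
      ∀ K : ℕ, ∃ ν₀ : ℝ, 0 < ν₀ ∧ ∀ ν : ℝ, 0 < ν → ν ≤ ν₀ → ∀ s : ℝ, 0 < s →
      ∀ X : Fin 4 → ℤ → ℝ → ℝ,
      (∀ (i : Fin 4) (k : ℤ), X i k 0 = if k = 0 then X₀ i else 0) →
      (∀ (i : Fin 4) (k : ℤ), k < 0 → ∀ t : ℝ, X i k t = 0) →
      (∃ M : ℝ, ∀ (t : ℝ) (i : Fin 4) (k : ℤ), (1 + (1 + ε₀) ^ ((10 : ℝ) * k)) * |X i k t| ≤ M) →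
      (∀ (i : Fin 4) (k : ℤ), Continuous (X i k)) →
      (∀ (i : Fin 4) (k : ℤ), ∀ t ∈ Set.Icc (0 : ℝ) s, HasDerivWithinAt (X i k)
      (quadTerm ε₀ sideBranchTable X i k t - ν * (1 + ε₀) ^ ((2 : ℝ) * k) * X i k t)
      (Set.Icc (0 : ℝ) s) t) →
      (∀ t ∈ Set.Icc (0 : ℝ) s, ∀ (i : Fin 4) (k : ℤ), 1 ≤ k → 0 ≤ X i k t) →
      (∀ n N : ℕ, n ≤ N → ∀ u ∈ Set.Icc (0 : ℝ) s,
      ∑ k ∈ Finset.Icc n N, ∑ i : Fin 4, (1 / 2 : ℝ) * X i (k : ℤ) u ^ 2 ≤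
      C * (∑ i : Fin 4, (1 / 2 : ℝ) * X₀ i ^ 2) * (1 + ε₀) ^ (-(2 * θ * (n : ℝ)))) →
      ∀ t ∈ Set.Icc (0 : ℝ) s,
      (∑ j ∈ Finset.range (K + 1), (1 / 2 : ℝ) * X 2 (j : ℤ) t ^ 2) ≤
      (1 - q) * (∑ i : Fin 4, (1 / 2 : ℝ) * X₀ i ^ 2)) :
    SideBranchCeilingEscapeAt ε₀ := by
  refine sideBranchCeilingEscapeAt_of_fractionEscape hε (half_pos hq) fun θ hθ C hC => ?_
  obtain ⟨X₀, hX0, hX1, hX2, hX3, hE₀, hK⟩ := h θ hθ C hC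
  set E₀ : ℝ := ∑ i : Fin 4, (1 / 2 : ℝ) * X₀ i ^ 2 with hE₀def
  refine ⟨X₀, hE₀, fun K => ?_⟩
  -- cap and level
  set Z : ℝ := Real.sqrt (2 * C * E₀) + 1 with hZdef
  have hZ : 0 < Z := by have := Real.sqrt_nonneg (2 * C * E₀); rw [hZdef]; linarith
  set ρ : ℝ := min 1 (q / 2 * E₀ / ((K : ℝ) + 1)) with hρdef
  have hρ : 0 < ρ := lt_min one_pos (by positivity)
  have hρ1 : ρ ≤ 1 := min_le_left _ _
  have hρq : ((K : ℝ) + 1) * ρ ^ 2 ≤ q / 2 * E₀ := by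
    have h1 : ρ ^ 2 ≤ ρ := by nlinarith
    have h2 : ρ ≤ q / 2 * E₀ / ((K : ℝ) + 1) := min_le_right _ _
    have h3 : ((K : ℝ) + 1) * ρ ≤ q / 2 * E₀ := by
      rw [le_div_iff₀ (by positivity)] at h2; linarith
    have h4 : ((K : ℝ) + 1) * ρ ^ 2 ≤ ((K : ℝ) + 1) * ρ := mul_le_mul_of_nonneg_left h1 (by positivity)
    linarith
  obtain ⟨T₀, hT₀, ν₀', hν₀', hblock⟩ := sideBranch_block_transit_relax hε hZ K hρ
  obtain ⟨ν₀'', hν₀'', hpark⟩ := hK K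
  refine ⟨T₀, hT₀, min ν₀' ν₀'', lt_min hν₀' hν₀'', fun ν hν hνle => ⟨T₀, hT₀, le_rfl, ?_⟩⟩
  intro X hinit hlow hbd hcont hder hpos hceil
  have hν1 : ν ≤ ν₀' := hνle.trans (min_le_left _ _)
  have hν2 : ν ≤ ν₀'' := hνle.trans (min_le_right _ _)
  -- signs on every shell `≥ 0`
  have hx00 : 0 ≤ X 0 0 0 := by rw [hinit 0 0]; simpa using hX0
  have hs00 : 0 ≤ X 1 0 0 := by rw [hinit 1 0]; simpa using hX1
  have hz00 : 0 ≤ X 2 0 0 := by rw [hinit 2 0]; simpa using hX2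
  have hw0 : ∀ k : ℤ, X 3 k 0 = 0 := by
    intro k; rw [hinit 3 k]; by_cases hk : k = 0 <;> simp [hk, hX3]
  have hposAll : ∀ t ∈ Icc (0 : ℝ) T₀, ∀ (i : Fin 4) (j : ℤ), 0 ≤ j → 0 ≤ X i j t := by
    intro t ht i j hj
    rcases lt_or_eq_of_le hj with hj1 | hj0
    · exact hpos t ht i j (by omega)
    · subst hj0
      fin_cases i
      · exact sideBranch_chain_zero_nonneg hlow hcont hder hx00 ht
      · exact sideBranch_side_zero_nonneg hε hcont hder hs00 ht
      · exact sideBranch_pocket_zero_nonneg hε hder hz00 ht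
      · exact (sideBranch_idle_eq_zero hder 0 (hw0 0) ht).symm.le
  -- the pocket cap from the ceiling
  have hcap : ∀ t ∈ Icc (0 : ℝ) T₀, ∀ j : ℤ, X 2 j t ≤ Z := by
    intro t ht j
    have h1 := sideBranch_pocket_le_of_ceiling (X := X) hε (by linarith : (0 : ℝ) ≤ θ) hC hE₀.le hlow
      hceil ht j
    rw [hZdef]; linarith
  -- block relaxation at `u = T₀`
  have hrel := hblock ν hν hν1 T₀ X hlow hder hposAll hcap T₀ ⟨le_rfl, le_rfl⟩
  -- parking bound at `t = T₀`
  have hpk := hpark ν hν hν2 T₀ hT₀ X hinit hlow hbd hcont hder hpos hceil T₀ ⟨hT₀.le, le_rfl⟩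
  -- bookkeeping: block energy = transit part + pockets (idle = 0)
  have hT₀mem : T₀ ∈ Icc (0 : ℝ) T₀ := ⟨hT₀.le, le_rfl⟩
  have hsplit : (∑ k ∈ Finset.range (K + 1), ∑ i : Fin 4, (1 / 2 : ℝ) * X i (k : ℤ) T₀ ^ 2) =
      (∑ k ∈ Finset.range (K + 1), ((1 / 2 : ℝ) * X 0 (k : ℤ) T₀ ^ 2 + (1 / 2 : ℝ) * X 1 (k : ℤ) T₀ ^ 2)) +
        ∑ k ∈ Finset.range (K + 1), (1 / 2 : ℝ) * X 2 (k : ℤ) T₀ ^ 2 := by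
    rw [← Finset.sum_add_distrib]
    refine Finset.sum_congr rfl fun k _ => ?_
    rw [Fin.sum_univ_four, sideBranch_idle_eq_zero hder (k : ℤ) (hw0 k) hT₀mem]
    ring
  have htransit := sideBranch_block_transit_energy (X := X) (K := K) (ρ := ρ) (u := T₀)
    (fun k _ => ⟨hposAll T₀ hT₀mem 0 k (by positivity), hposAll T₀ hT₀mem 1 k (by positivity)⟩)
    (fun k hk => hrel k hk)
  rw [hsplit]
  have : (1 - q / 2) * E₀ = q / 2 * E₀ + (1 - q) * E₀ := by ring
  rw [this]
  exact add_le_add (htransit.trans hρq) hpk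

/-- **`OrthantTailCeiling` (stmt-25507) BY NAME modulo the uniform parking bound at some `ε₀ ∈ (0,1]`**
(hypothesis inline, shape of `sideBranchCeilingEscapeAt_of_parkingBound`).  MODEL lattice only;
conditional; settles nothing by itself. [this file] -/
theorem orthantTailCeiling_false_of_parkingBound
    (h : ∃ ε₀ : ℝ, 0 < ε₀ ∧ ε₀ ≤ 1 ∧ ∃ q : ℝ, 0 < q ∧
      ∀ θ : ℝ, 1 / 2 < θ → ∀ C : ℝ, 0 ≤ C →
      ∃ X₀ : Fin 4 → ℝ, 0 ≤ X₀ 0 ∧ 0 ≤ X₀ 1 ∧ 0 ≤ X₀ 2 ∧ X₀ 3 = 0 ∧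
      0 < (∑ i : Fin 4, (1 / 2 : ℝ) * X₀ i ^ 2) ∧
      ∀ K : ℕ, ∃ ν₀ : ℝ, 0 < ν₀ ∧ ∀ ν : ℝ, 0 < ν → ν ≤ ν₀ → ∀ s : ℝ, 0 < s →
      ∀ X : Fin 4 → ℤ → ℝ → ℝ,
      (∀ (i : Fin 4) (k : ℤ), X i k 0 = if k = 0 then X₀ i else 0) →
      (∀ (i : Fin 4) (k : ℤ), k < 0 → ∀ t : ℝ, X i k t = 0) →
      (∃ M : ℝ, ∀ (t : ℝ) (i : Fin 4) (k : ℤ), (1 + (1 + ε₀) ^ ((10 : ℝ) * k)) * |X i k t| ≤ M) →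
      (∀ (i : Fin 4) (k : ℤ), Continuous (X i k)) →
      (∀ (i : Fin 4) (k : ℤ), ∀ t ∈ Set.Icc (0 : ℝ) s, HasDerivWithinAt (X i k)
      (quadTerm ε₀ sideBranchTable X i k t - ν * (1 + ε₀) ^ ((2 : ℝ) * k) * X i k t)
      (Set.Icc (0 : ℝ) s) t) →
      (∀ t ∈ Set.Icc (0 : ℝ) s, ∀ (i : Fin 4) (k : ℤ), 1 ≤ k → 0 ≤ X i k t) →
      (∀ n N : ℕ, n ≤ N → ∀ u ∈ Set.Icc (0 : ℝ) s,
      ∑ k ∈ Finset.Icc n N, ∑ i : Fin 4, (1 / 2 : ℝ) * X i (k : ℤ) u ^ 2 ≤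
      C * (∑ i : Fin 4, (1 / 2 : ℝ) * X₀ i ^ 2) * (1 + ε₀) ^ (-(2 * θ * (n : ℝ)))) →
      ∀ t ∈ Set.Icc (0 : ℝ) s,
      (∑ j ∈ Finset.range (K + 1), (1 / 2 : ℝ) * X 2 (j : ℤ) t ^ 2) ≤
      (1 - q) * (∑ i : Fin 4, (1 / 2 : ℝ) * X₀ i ^ 2)) :
    ¬ OrthantTailCeiling := by
  obtain ⟨ε₀, hε, hε1, q, hq, hpark⟩ := h
  exact orthantTailCeiling_false_of_sideBranchCeilingEscape
    ⟨ε₀, hε, hε1, sideBranchCeilingEscapeAt_of_parkingBound hε hq hpark⟩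

/-- **`ForwardTailCeiling` (stmt-26608) BY NAME modulo the uniform parking bound at some `ε₀ ∈ (0,1]`**
(twin reduction of record).  MODEL lattice only; conditional; settles nothing by itself. [this file] -/
theorem forwardTailCeiling_false_of_parkingBound
    (h : ∃ ε₀ : ℝ, 0 < ε₀ ∧ ε₀ ≤ 1 ∧ ∃ q : ℝ, 0 < q ∧
      ∀ θ : ℝ, 1 / 2 < θ → ∀ C : ℝ, 0 ≤ C →
      ∃ X₀ : Fin 4 → ℝ, 0 ≤ X₀ 0 ∧ 0 ≤ X₀ 1 ∧ 0 ≤ X₀ 2 ∧ X₀ 3 = 0 ∧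
      0 < (∑ i : Fin 4, (1 / 2 : ℝ) * X₀ i ^ 2) ∧
      ∀ K : ℕ, ∃ ν₀ : ℝ, 0 < ν₀ ∧ ∀ ν : ℝ, 0 < ν → ν ≤ ν₀ → ∀ s : ℝ, 0 < s →
      ∀ X : Fin 4 → ℤ → ℝ → ℝ,
      (∀ (i : Fin 4) (k : ℤ), X i k 0 = if k = 0 then X₀ i else 0) →
      (∀ (i : Fin 4) (k : ℤ), k < 0 → ∀ t : ℝ, X i k t = 0) →
      (∃ M : ℝ, ∀ (t : ℝ) (i : Fin 4) (k : ℤ), (1 + (1 + ε₀) ^ ((10 : ℝ) * k)) * |X i k t| ≤ M) →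
      (∀ (i : Fin 4) (k : ℤ), Continuous (X i k)) →
      (∀ (i : Fin 4) (k : ℤ), ∀ t ∈ Set.Icc (0 : ℝ) s, HasDerivWithinAt (X i k)
      (quadTerm ε₀ sideBranchTable X i k t - ν * (1 + ε₀) ^ ((2 : ℝ) * k) * X i k t)
      (Set.Icc (0 : ℝ) s) t) →
      (∀ t ∈ Set.Icc (0 : ℝ) s, ∀ (i : Fin 4) (k : ℤ), 1 ≤ k → 0 ≤ X i k t) →
      (∀ n N : ℕ, n ≤ N → ∀ u ∈ Set.Icc (0 : ℝ) s,
      ∑ k ∈ Finset.Icc n N, ∑ i : Fin 4, (1 / 2 : ℝ) * X i (k : ℤ) u ^ 2 ≤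
      C * (∑ i : Fin 4, (1 / 2 : ℝ) * X₀ i ^ 2) * (1 + ε₀) ^ (-(2 * θ * (n : ℝ)))) →
      ∀ t ∈ Set.Icc (0 : ℝ) s,
      (∑ j ∈ Finset.range (K + 1), (1 / 2 : ℝ) * X 2 (j : ℤ) t ^ 2) ≤
      (1 - q) * (∑ i : Fin 4, (1 / 2 : ℝ) * X₀ i ^ 2)) :
    ¬ ForwardTailCeiling := by
  obtain ⟨ε₀, hε, hε1, q, hq, hpark⟩ := h
  exact forwardTailCeiling_false_of_sideBranchCeilingEscape
    ⟨ε₀, hε, hε1, sideBranchCeilingEscapeAt_of_parkingBound hε hq hpark⟩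

end Summit.NavierStokesRegularity.NavierStokesRegularity.Theorems.SubOnsagerCeiling

end
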